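import Mathlib
import Summits.MatrixMultiplication.MatrixMultiplication.Theorems.SubgroupIdentityDesigns.Negative.LevelOneClassification

/-!
# A level-`k` character count uniform in `m`, and the small-`ε` no-go at EVERY level
# (support lemma for the crux `SubgroupIdentityDesigns`, stmt-MatrixMultiplication-14079; cell B2b-5
# `b2b-lgcu-borel`, gen 11 — report `run/shared/lean/b2b/levelgraded-cu/ORACLE-g11.md` §G11-5)

`G = GL_m(𝔽_p)`, `F_k|_G = levelSubmodule p m k`.  The landed packing law `PackingBridge.crux_law` says a
witness of the crux at `ε` forces `2^{(2+ε)/3} < #(Irr(G) ∩ F_k)^ε`.  Here we bound the count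
UNIFORMLY IN `m`:

* `levelSubmodule_le_span_transport` — `F_k|_G` is spanned by the frame transports `g ↦ [g U = A]`,
  `U, A ∈ M_{m×k}(𝔽_p)` (rank factorisation `M = U W` of the modes).
* `exists_gl_mul_eq_of_ker_iff` — matrices `X, X' ∈ M_{m×ι}` with the same right kernel are
  LEFT-EQUIVALENT: `X' = g X`, `g ∈ GL_m(𝔽_p)` (the canonical `im X ≅ 𝔽_p^ι/ker ≅ im X'` extended by an
  isomorphism of complements; no echelon forms).
* `ncard_irr_level_le` — **`#(Irr(GL_m(𝔽_p)) ∩ F_k) ≤ #{subspaces of 𝔽_p^{2k}}`** for every `m`: an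
  irreducible character in `F_k` is a class function, hence `|G|⁻¹` times its conjugation-sum; the
  conjugation-sum of a transport `[g U = A]` depends only on the `GL_m`-orbit of the pair `(U, A)`, i.e.
  (previous item) only on the kernel of `[U | A] : 𝔽_p^{2k} → 𝔽_p^m`; and distinct irreducible characters
  are linearly independent (`linearIndependent_irrChars`).
* `natCard_submodule_le` — the crude count `#{subspaces of 𝔽_p^{2k}} ≤ p^{4k²}`.
* `no_witness_small_eps`, `no_witness_small_eps'` — **NO LEVEL-`k` WITNESS OF THE CRUX IN ANY
  `GL_m(𝔽_p)`, `m` ARBITRARY, once `#{subspaces of 𝔽_p^{2k}}^ε ≤ 2^{(2+ε)/3}`, in particular once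
  `p^{4k²ε} ≤ 2^{(2+ε)/3}`**, i.e. for `ε ≤ 2 log 2 / (12 k² log p − log 2)`.  This is the graded analogue
  of `crux_no_fixed_host`: a witness family for `ε → 0` must have `k² log p → ∞` — no fixed level over a
  fixed field can serve, whatever the dimension `m`.  (The true count is `Σ_{j≤k} #Irr(GL_j(𝔽_p)) ≈ p^k`
  for `m ≥ 2k` — Gurevich–Howe tensor rank; the level-one case `= p` is `LevelOneClassification`.)
Sorry-free; standard axioms.  VALUE = theorem (a structural constraint on witnesses), NOT summit progress. -/

set_option linter.dupNamespace false

open scoped BigOperators Classical Matrix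
open Module (finrank)

namespace Summit.MatrixMultiplication.MatrixMultiplication.Theorems.SubgroupIdentityDesigns.Negative
namespace LevelCount

open Literature.RepresentationTheory.FiniteGroups
open Literature.Barriers.MatrixMultiplication (SubgroupTPP)
open Summit.MatrixMultiplication.MatrixMultiplication.Theorems.LieRankDesigns.Negative
open Summit.MatrixMultiplication.MatrixMultiplication.Theorems.LevelOneGL2Designs.Negative
  (levelSubmodule mem_levelSubmodule_iff)
open PackingBridge (coe_levelSubmodule budget_eq crux_law)
open FrameGhost (wave_eq_sum_transport)
open Literature.Computability.AlgebraicComplexity (exists_eq_mul_of_rank_le)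

variable {p : ℕ} [hp : Fact p.Prime] {m : ℕ}

/-! ## Transports span `F_k` -/

/-- **`F_k|_G ⊆ span{[g U = A] : U, A ∈ M_{m×k}}`** (a mode of rank `≤ k` factors as `M = U W`, and
`ψ(tr(U W g)) = Σ_A [g U = A] ψ(tr(W A))`). -/
theorem levelSubmodule_le_span_transport {k : ℕ} :
    levelSubmodule p m k ≤ Submodule.span ℂ (Set.range fun UA :
      Matrix (Fin m) (Fin k) (ZMod p) × Matrix (Fin m) (Fin k) (ZMod p) =>
        fun g : GLm p m => if (g : Mat p m) * UA.1 = UA.2 then (1 : ℂ) else 0) := by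
  intro f hf
  obtain ⟨c, hc, hfc⟩ := mem_levelSubmodule_iff.mp hf
  have hf' : f = ∑ M : Mat p m,
      c M • fun g : GLm p m => ZMod.stdAddChar (Matrix.trace (M * (g : Mat p m))) := by
    funext g
    rw [hfc g, Finset.sum_apply]
    simp only [fourierFn, Pi.smul_apply, smul_eq_mul]
  rw [hf']
  refine Submodule.sum_mem _ fun M _ => ?_
  by_cases hM : k < M.rank
  · rw [hc M hM, zero_smul]; exact Submodule.zero_mem _
  refine Submodule.smul_mem _ _ ?_
  obtain ⟨U, W, rfl⟩ := exists_eq_mul_of_rank_le M (not_lt.mp hM)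
  have hw : (fun g : GLm p m => ZMod.stdAddChar (Matrix.trace (U * W * (g : Mat p m)))) =
      ∑ A : Matrix (Fin m) (Fin k) (ZMod p), ZMod.stdAddChar (Matrix.trace (W * A)) •
        fun g : GLm p m => if (g : Mat p m) * U = A then (1 : ℂ) else 0 := by
    funext g
    rw [wave_eq_sum_transport, Finset.sum_apply]
    refine Finset.sum_congr rfl fun A _ => ?_
    simp only [Pi.smul_apply, smul_eq_mul, mul_ite, mul_one, mul_zero]
  rw [hw]
  exact Submodule.sum_mem _ fun A _ => Submodule.smul_mem _ _ (Submodule.subset_span ⟨(U, A), rfl⟩)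

/-! ## Same kernel ⇒ same `GL_m`-orbit -/
/-- **Matrices with the same right kernel are left-equivalent under `GL_m`**: if `X v = 0 ↔ X' v = 0`
for all `v`, then `X' = g X` for some `g ∈ GL_m(𝔽_p)` (extend the canonical isomorphism
`im X ≅ 𝔽_p^ι / ker ≅ im X'` by an isomorphism of complements). [folklore] -/
theorem exists_gl_mul_eq_of_ker_iff {ι : Type} [Fintype ι] [DecidableEq ι]
    (X X' : Matrix (Fin m) ι (ZMod p)) (h : ∀ v : ι → ZMod p, X *ᵥ v = 0 ↔ X' *ᵥ v = 0) :
    ∃ g : GLm p m, (g : Mat p m) * X = X' := by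
  set f : (ι → ZMod p) →ₗ[ZMod p] (Fin m → ZMod p) := Matrix.toLin' X with hf
  set f' : (ι → ZMod p) →ₗ[ZMod p] (Fin m → ZMod p) := Matrix.toLin' X' with hf'
  have hker : LinearMap.ker f = LinearMap.ker f' := by
    ext v
    rw [LinearMap.mem_ker, LinearMap.mem_ker, hf, hf', Matrix.toLin'_apply, Matrix.toLin'_apply]
    exact h v
  -- the canonical isomorphism `range f ≃ range f'`
  let φ : LinearMap.range f ≃ₗ[ZMod p] LinearMap.range f' :=
    f.quotKerEquivRange.symm.trans
      ((Submodule.quotEquivOfEq _ _ hker).trans f'.quotKerEquivRange)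
  have hφ : ∀ v : ι → ZMod p,
      ((φ ⟨f v, LinearMap.mem_range_self f v⟩ : LinearMap.range f') : Fin m → ZMod p) = f' v := by
    intro v
    have h1 : f.quotKerEquivRange.symm ⟨f v, LinearMap.mem_range_self f v⟩ =
        Submodule.Quotient.mk v := by
      rw [LinearEquiv.symm_apply_eq]
      ext
      rw [LinearMap.quotKerEquivRange_apply_mk]
    show (( f'.quotKerEquivRange ((Submodule.quotEquivOfEq _ _ hker)
      (f.quotKerEquivRange.symm ⟨f v, LinearMap.mem_range_self f v⟩)) : LinearMap.range f') :
        Fin m → ZMod p) = f' v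
    rw [h1, Submodule.quotEquivOfEq_mk, LinearMap.quotKerEquivRange_apply_mk]
  -- complements and their identification
  obtain ⟨C, hC⟩ := Submodule.exists_isCompl (LinearMap.range f)
  obtain ⟨C', hC'⟩ := Submodule.exists_isCompl (LinearMap.range f')
  have hdim : finrank (ZMod p) C = finrank (ZMod p) C' := by
    have h1 := Submodule.finrank_add_eq_of_isCompl hC
    have h2 := Submodule.finrank_add_eq_of_isCompl hC'
    have h3 : finrank (ZMod p) (LinearMap.range f) = finrank (ZMod p) (LinearMap.range f') :=
      φ.finrank_eq
    omega
  let ψ : C ≃ₗ[ZMod p] C' := LinearEquiv.ofFinrankEq C C' hdim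
  let E : (Fin m → ZMod p) ≃ₗ[ZMod p] (Fin m → ZMod p) :=
    (Submodule.prodEquivOfIsCompl _ C hC).symm.trans
      ((φ.prodCongr ψ).trans (Submodule.prodEquivOfIsCompl _ C' hC'))
  have hE : ∀ v : ι → ZMod p, E (f v) = f' v := by
    intro v
    show Submodule.prodEquivOfIsCompl _ C' hC' ((φ.prodCongr ψ)
      ((Submodule.prodEquivOfIsCompl _ C hC).symm
        (((⟨f v, LinearMap.mem_range_self f v⟩ : LinearMap.range f) : Fin m → ZMod p)))) = f' v
    rw [Submodule.prodEquivOfIsCompl_symm_apply_left, LinearEquiv.prodCongr_apply,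
      Submodule.coe_prodEquivOfIsCompl', map_zero, Submodule.coe_zero, add_zero]
    exact hφ v
  -- the matrix of `E`
  have hcomp : (E : (Fin m → ZMod p) →ₗ[ZMod p] (Fin m → ZMod p)).comp f = f' := by
    apply LinearMap.ext
    intro v
    rw [LinearMap.comp_apply]
    exact hE v
  have h1 : LinearMap.toMatrix' (E : (Fin m → ZMod p) →ₗ[ZMod p] (Fin m → ZMod p)) *
      LinearMap.toMatrix' (E.symm : (Fin m → ZMod p) →ₗ[ZMod p] (Fin m → ZMod p)) = 1 := by
    rw [← LinearMap.toMatrix'_comp, ← LinearMap.toMatrix'_id]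
    congr 1
    apply LinearMap.ext
    intro v
    simp
  have h2 : LinearMap.toMatrix' (E.symm : (Fin m → ZMod p) →ₗ[ZMod p] (Fin m → ZMod p)) *
      LinearMap.toMatrix' (E : (Fin m → ZMod p) →ₗ[ZMod p] (Fin m → ZMod p)) = 1 := by
    rw [← LinearMap.toMatrix'_comp, ← LinearMap.toMatrix'_id]
    congr 1
    apply LinearMap.ext
    intro v
    simp
  refine ⟨⟨_, _, h1, h2⟩, ?_⟩
  show LinearMap.toMatrix' (E : (Fin m → ZMod p) →ₗ[ZMod p] (Fin m → ZMod p)) * X = X'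
  calc LinearMap.toMatrix' (E : (Fin m → ZMod p) →ₗ[ZMod p] (Fin m → ZMod p)) * X
      = LinearMap.toMatrix' (E : (Fin m → ZMod p) →ₗ[ZMod p] (Fin m → ZMod p)) *
          LinearMap.toMatrix' f := by rw [hf, LinearMap.toMatrix'_toLin']
    _ = LinearMap.toMatrix' ((E : (Fin m → ZMod p) →ₗ[ZMod p] (Fin m → ZMod p)).comp f) := by
          rw [LinearMap.toMatrix'_comp]
    _ = X' := by rw [hcomp, hf', LinearMap.toMatrix'_toLin']

/-! ## Conjugation sums -/

/-- The conjugation-sum of a transport is constant along the `GL_m`-orbit of the pair: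
`Σ_h [h g h⁻¹ (g₀U) = g₀A] = Σ_h [h g h⁻¹ U = A]`. -/
theorem conjSum_transport_eq {k : ℕ} (U A : Matrix (Fin m) (Fin k) (ZMod p)) (g₀ : GLm p m) :
    (fun g : GLm p m => ∑ h : GLm p m,
        (if ((h * g * h⁻¹ : GLm p m) : Mat p m) * ((g₀ : Mat p m) * U) = (g₀ : Mat p m) * A
          then (1 : ℂ) else 0)) =
      fun g : GLm p m => ∑ h : GLm p m,
        (if ((h * g * h⁻¹ : GLm p m) : Mat p m) * U = A then (1 : ℂ) else 0) := by
  funext g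
  rw [← Equiv.sum_comp (Equiv.mulLeft g₀⁻¹) (fun h : GLm p m =>
    (if ((h * g * h⁻¹ : GLm p m) : Mat p m) * U = A then (1 : ℂ) else 0))]
  refine Finset.sum_congr rfl fun h _ => ?_
  have e1 : (g₀⁻¹ * h * g * (g₀⁻¹ * h)⁻¹ : GLm p m) = g₀⁻¹ * (h * g * h⁻¹) * g₀ := by group
  simp only [Equiv.coe_mulLeft, e1]
  set X : Mat p m := ((h * g * h⁻¹ : GLm p m) : Mat p m) with hX
  have hiff : X * ((g₀ : Mat p m) * U) = (g₀ : Mat p m) * A ↔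
      ((g₀⁻¹ * (h * g * h⁻¹) * g₀ : GLm p m) : Mat p m) * U = A := by
    rw [Units.val_mul, Units.val_mul, ← hX]
    constructor
    · intro e
      calc ((g₀⁻¹ : GLm p m) : Mat p m) * X * (g₀ : Mat p m) * U
          = ((g₀⁻¹ : GLm p m) : Mat p m) * (X * ((g₀ : Mat p m) * U)) := by
            simp only [Matrix.mul_assoc]
        _ = A := by rw [e, ← Matrix.mul_assoc, Units.inv_mul, Matrix.one_mul]
    · intro e
      calc X * ((g₀ : Mat p m) * U)
          = (g₀ : Mat p m) * (((g₀⁻¹ : GLm p m) : Mat p m) * (X * ((g₀ : Mat p m) * U))) := by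
            rw [← Matrix.mul_assoc (g₀ : Mat p m), Units.mul_inv, Matrix.one_mul]
        _ = (g₀ : Mat p m) * (((g₀⁻¹ : GLm p m) : Mat p m) * X * (g₀ : Mat p m) * U) := by
            simp only [Matrix.mul_assoc]
        _ = (g₀ : Mat p m) * A := by rw [e]
  simp only [hiff]

/-- The conjugation-sum of a class function `χ` is `|G| χ`. -/
theorem conjSum_classFun {χ : GLm p m → ℂ} (hχ : IsClassFun χ) :
    (fun g : GLm p m => ∑ h : GLm p m, χ (h * g * h⁻¹)) =
      fun g => (Fintype.card (GLm p m) : ℂ) * χ g := by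
  funext g
  rw [Finset.sum_congr rfl fun h _ => hχ g h, Finset.sum_const, Finset.card_univ, nsmul_eq_mul]

/-- Conjugation-summing maps `span S` into `span` of the conjugation-sums of `S`. -/
theorem conjSum_mem_span {S : Set (GLm p m → ℂ)} {f : GLm p m → ℂ} (hf : f ∈ Submodule.span ℂ S) :
    (fun g : GLm p m => ∑ h : GLm p m, f (h * g * h⁻¹)) ∈
      Submodule.span ℂ ((fun F : GLm p m → ℂ => fun g : GLm p m => ∑ h : GLm p m, F (h * g * h⁻¹)) '' S) := by
  refine Submodule.span_induction (p := fun f _ => (fun g : GLm p m => ∑ h : GLm p m, f (h * g * h⁻¹)) ∈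
      Submodule.span ℂ ((fun F : GLm p m → ℂ => fun g : GLm p m => ∑ h : GLm p m, F (h * g * h⁻¹)) '' S))
    ?_ ?_ ?_ ?_ hf
  · exact fun F hF => Submodule.subset_span ⟨F, hF, rfl⟩
  · have h0 : (fun g : GLm p m => ∑ h : GLm p m, (0 : GLm p m → ℂ) (h * g * h⁻¹)) = 0 := by
      funext g; simp
    rw [h0]; exact Submodule.zero_mem _
  · intro F F' _ _ hF hF'
    have hadd : (fun g : GLm p m => ∑ h : GLm p m, (F + F') (h * g * h⁻¹)) =
        (fun g : GLm p m => ∑ h : GLm p m, F (h * g * h⁻¹)) +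
          fun g : GLm p m => ∑ h : GLm p m, F' (h * g * h⁻¹) := by
      funext g; simp [Finset.sum_add_distrib]
    rw [hadd]; exact Submodule.add_mem _ hF hF'
  · intro a F _ hF
    have hsmul : (fun g : GLm p m => ∑ h : GLm p m, (a • F) (h * g * h⁻¹)) =
        a • fun g : GLm p m => ∑ h : GLm p m, F (h * g * h⁻¹) := by
      funext g; simp [Finset.mul_sum]
    rw [hsmul]; exact Submodule.smul_mem _ _ hF

/-! ## The count -/

/-- **LEVEL-`k` CHARACTER COUNT, UNIFORM IN `m`**:
`#(Irr(GL_m(𝔽_p)) ∩ F_k) ≤ #{subspaces of 𝔽_p^{2k}}` for every prime `p` and all `m, k`. -/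
theorem ncard_irr_level_le {k : ℕ} :
    (irrChars (GLm p m) ∩ levelSet p m k).ncard ≤
      Nat.card (Submodule (ZMod p) (Fin k ⊕ Fin k → ZMod p)) := by
  haveI : Fintype (Submodule (ZMod p) (Fin k ⊕ Fin k → ZMod p)) := Fintype.ofFinite _
  -- the three players: transports, conjugation-sum, kernel invariant
  set T : Matrix (Fin m) (Fin k) (ZMod p) × Matrix (Fin m) (Fin k) (ZMod p) → (GLm p m → ℂ) :=
    fun UA g => if (g : Mat p m) * UA.1 = UA.2 then (1 : ℂ) else 0 with hT
  set cs : (GLm p m → ℂ) → (GLm p m → ℂ) :=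
    fun F g => ∑ h : GLm p m, F (h * g * h⁻¹) with hcs
  set κ : Matrix (Fin m) (Fin k) (ZMod p) × Matrix (Fin m) (Fin k) (ZMod p) →
      Submodule (ZMod p) (Fin k ⊕ Fin k → ZMod p) :=
    fun UA => LinearMap.ker (Matrix.toLin' (Matrix.fromCols UA.1 UA.2)) with hκ
  -- (1) the conjugation-sum of a transport depends only on the kernel of `[U | A]`
  have hkey : ∀ UA UA', κ UA = κ UA' → cs (T UA) = cs (T UA') := by
    rintro ⟨U, A⟩ ⟨U', A'⟩ hK
    have hiff : ∀ v, Matrix.fromCols U A *ᵥ v = 0 ↔ Matrix.fromCols U' A' *ᵥ v = 0 := by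
      intro v
      have h := SetLike.ext_iff.mp hK v
      simp only [hκ, LinearMap.mem_ker, Matrix.toLin'_apply] at h
      exact h
    obtain ⟨g₀, hg₀⟩ := exists_gl_mul_eq_of_ker_iff _ _ hiff
    rw [Matrix.mul_fromCols, Matrix.fromCols_ext_iff] at hg₀
    obtain ⟨rfl, rfl⟩ := hg₀
    simp only [hcs, hT]
    exact (conjSum_transport_eq U A g₀).symm
  -- (2) hence at most `#{subspaces}` distinct conjugation-sums of transports
  have hR : (Finset.univ.image fun UA => cs (T UA)).card ≤
      Nat.card (Submodule (ZMod p) (Fin k ⊕ Fin k → ZMod p)) := by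
    have hfac : ∀ UA, cs (T UA) = (fun K : Submodule (ZMod p) (Fin k ⊕ Fin k → ZMod p) =>
        if h : ∃ UA', κ UA' = K then cs (T h.choose) else 0) (κ UA) := by
      intro UA
      have hex : ∃ UA', κ UA' = κ UA := ⟨UA, rfl⟩
      simp only [dif_pos hex]
      exact hkey UA hex.choose hex.choose_spec.symm
    calc (Finset.univ.image fun UA => cs (T UA)).card
        ≤ (Finset.univ.image fun K : Submodule (ZMod p) (Fin k ⊕ Fin k → ZMod p) =>
            if h : ∃ UA', κ UA' = K then cs (T h.choose) else 0).card := by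
          refine Finset.card_le_card fun F hF => ?_
          obtain ⟨UA, _, rfl⟩ := Finset.mem_image.mp hF
          exact Finset.mem_image.mpr ⟨κ UA, Finset.mem_univ _, (hfac UA).symm⟩
      _ ≤ (Finset.univ : Finset (Submodule (ZMod p) (Fin k ⊕ Fin k → ZMod p))).card :=
          Finset.card_image_le
      _ = Nat.card (Submodule (ZMod p) (Fin k ⊕ Fin k → ZMod p)) := by
          rw [Finset.card_univ, Nat.card_eq_fintype_card]
  -- (3) every irreducible level-`k` character lies in the span of those conjugation-sums
  set R : Finset (GLm p m → ℂ) := Finset.univ.image fun UA => cs (T UA) with hRdef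
  have hspan : ∀ χ ∈ irrChars (GLm p m) ∩ levelSet p m k, χ ∈ Submodule.span ℂ (↑R : Set (GLm p m → ℂ)) := by
    rintro χ ⟨hχ, hχk⟩
    have hmem : χ ∈ levelSubmodule p m k := by
      rw [← SetLike.mem_coe, coe_levelSubmodule]; exact hχk
    have h1 := conjSum_mem_span (levelSubmodule_le_span_transport hmem)
    have himg : ((fun F : GLm p m → ℂ => fun g : GLm p m => ∑ h : GLm p m, F (h * g * h⁻¹)) ''
        Set.range fun UA : Matrix (Fin m) (Fin k) (ZMod p) × Matrix (Fin m) (Fin k) (ZMod p) =>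
          fun g : GLm p m => if (g : Mat p m) * UA.1 = UA.2 then (1 : ℂ) else 0) ⊆ ↑R := by
      rintro F ⟨F', ⟨UA, rfl⟩, rfl⟩
      rw [hRdef, Finset.coe_image, Finset.coe_univ, Set.image_univ]
      exact ⟨UA, rfl⟩
    have h2 := Submodule.span_mono himg h1
    rw [conjSum_classFun hχ.isCharacter.isClassFun] at h2
    have hc : (Fintype.card (GLm p m) : ℂ) ≠ 0 := Nat.cast_ne_zero.mpr Fintype.card_ne_zero
    have h3 := Submodule.smul_mem _ ((Fintype.card (GLm p m) : ℂ)⁻¹) h2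
    have e : ((Fintype.card (GLm p m) : ℂ)⁻¹ • fun g => (Fintype.card (GLm p m) : ℂ) * χ g) = χ := by
      funext g
      simp only [Pi.smul_apply, smul_eq_mul]
      rw [← mul_assoc, inv_mul_cancel₀ hc, one_mul]
    rwa [e] at h3
  -- (4) linear independence
  have hfin : (irrChars (GLm p m) ∩ levelSet p m k).Finite :=
    (irrChars_finite_holds (GLm p m)).subset Set.inter_subset_left
  letI : Fintype (↥(irrChars (GLm p m) ∩ levelSet p m k)) := hfin.fintype
  have hli : LinearIndependent ℂ (fun χ : (irrChars (GLm p m) ∩ levelSet p m k : Set (GLm p m → ℂ)) =>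
      (χ : GLm p m → ℂ)) :=
    (linearIndependent_irrChars (G := GLm p m)).comp
      (Set.inclusion Set.inter_subset_left) (Set.inclusion_injective _)
  have hle := linearIndependent_le_span_aux' _ hli (↑R : Set (GLm p m → ℂ)) (by
    rintro F ⟨χ, rfl⟩
    exact hspan χ χ.2)
  rw [← Nat.card_coe_set_eq, Nat.card_eq_fintype_card]
  calc Fintype.card (↥(irrChars (GLm p m) ∩ levelSet p m k))
      ≤ Fintype.card (↑R : Set (GLm p m → ℂ)) := hle
    _ = R.card := by simp
    _ ≤ _ := hR

/-! ## A crude subspace count and the all-level no-go -/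

/-- `#{submodules of V} ≤ |V|^{dim V}` (every subspace is spanned by a `dim V`-tuple). [folklore] -/
theorem natCard_submodule_le_general {K V : Type} [Field K] [AddCommGroup V] [Module K V]
    [FiniteDimensional K V] [Finite V] :
    Nat.card (Submodule K V) ≤ Nat.card V ^ finrank K V := by
  have hsurj : Function.Surjective fun v : Fin (finrank K V) → V => Submodule.span K (Set.range v) := by
    intro W
    set d := finrank K W with hd
    have hdn : d ≤ finrank K V := Submodule.finrank_le W
    let b := Module.finBasis K W
    refine ⟨fun i => if h : (i : ℕ) < d then ((b ⟨i, h⟩ : W) : V) else 0, ?_⟩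
    apply le_antisymm
    · refine Submodule.span_le.mpr ?_
      rintro v ⟨i, rfl⟩
      by_cases h : (i : ℕ) < d
      · simp only [dif_pos h]; exact Submodule.coe_mem _
      · simp only [dif_neg h]; exact Submodule.zero_mem _
    · have hW : W = Submodule.span K (W.subtype '' Set.range b) := by
        rw [Submodule.span_image, b.span_eq, Submodule.map_subtype_top]
      show W ≤ Submodule.span K (Set.range _)
      refine hW.le.trans (Submodule.span_mono ?_)
      rintro v ⟨w, ⟨j, rfl⟩, rfl⟩
      have hj : (j : ℕ) < d := by rw [hd]; exact j.2
      refine ⟨⟨j, lt_of_lt_of_le hj hdn⟩, ?_⟩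
      simp only [dif_pos hj, Fin.eta, Submodule.coe_subtype]
  calc Nat.card (Submodule K V) ≤ Nat.card (Fin (finrank K V) → V) :=
        Nat.card_le_card_of_surjective _ hsurj
    _ = Nat.card V ^ finrank K V := by
        rw [Nat.card_fun, Nat.card_eq_fintype_card (α := Fin (finrank K V)), Fintype.card_fin]

/-- **`#{subspaces of 𝔽_p^{2k}} ≤ p^{4k²}`**. -/
theorem natCard_submodule_le {k : ℕ} :
    Nat.card (Submodule (ZMod p) (Fin k ⊕ Fin k → ZMod p)) ≤ p ^ (4 * k ^ 2) := by
  have h := natCard_submodule_le_general (K := ZMod p) (V := Fin k ⊕ Fin k → ZMod p)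
  have e1 : finrank (ZMod p) (Fin k ⊕ Fin k → ZMod p) = k + k := by
    rw [Module.finrank_fintype_fun_eq_card, Fintype.card_sum, Fintype.card_fin]
  have e2 : Nat.card (Fin k ⊕ Fin k → ZMod p) = p ^ (k + k) := by
    rw [Nat.card_fun, Nat.card_zmod, Nat.card_eq_fintype_card (α := Fin k ⊕ Fin k), Fintype.card_sum,
      Fintype.card_fin]
  rw [e1, e2, ← pow_mul] at h
  have e : (k + k) * (k + k) = 4 * k ^ 2 := by ring
  rwa [e] at h

/-- **NO LEVEL-`k` WITNESS IN ANY `GL_m(𝔽_p)` ONCE `#{subspaces of 𝔽_p^{2k}}^ε ≤ 2^{(2+ε)/3}`**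
(uniform in `m`; from `crux_law` and `ncard_irr_level_le`). -/
theorem no_witness_small_eps {k : ℕ} {ε : ℝ} (hε : 0 < ε)
    (hthr : (Nat.card (Submodule (ZMod p) (Fin k ⊕ Fin k → ZMod p)) : ℝ) ^ ε ≤
      (2 : ℝ) ^ ((2 + ε) / 3))
    {H₁ H₂ H₃ : Subgroup (GLm p m)} (htpp : SubgroupTPP H₁ H₂ H₃)
    (hdes : ∃ c : Mat p m → ℂ, (∀ M, k < M.rank → c M = 0) ∧
      (∑ M, c M * ZMod.stdAddChar (Matrix.trace (M * ((1 : GLm p m) : Mat p m)))) = 1 ∧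
      ∀ a ∈ H₁, ∀ b ∈ H₂, ∀ g ∈ H₃, a * b * g ≠ 1 →
        (∑ M, c M * ZMod.stdAddChar
          (Matrix.trace (M * ((a * b * g : GLm p m) : Mat p m)))) = 0) :
    ¬ budget p m k (2 + ε) <
      ((Nat.card H₁ * Nat.card H₂ * Nat.card H₃ : ℕ) : ℝ) ^ ((2 + ε) / 3) := by
  intro hlt
  have h := crux_law hε htpp hdes hlt
  have hN : ((irrChars (GLm p m) ∩ levelSet p m k).ncard : ℝ) ≤
      (Nat.card (Submodule (ZMod p) (Fin k ⊕ Fin k → ZMod p)) : ℝ) := by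
    exact_mod_cast ncard_irr_level_le (p := p) (m := m) (k := k)
  have h2 := Real.rpow_le_rpow (Nat.cast_nonneg _) hN hε.le
  linarith

/-- **NO LEVEL-`k` WITNESS IN ANY `GL_m(𝔽_p)` ONCE `p^{4k²ε} ≤ 2^{(2+ε)/3}`**, i.e. for
`ε ≤ 2 log 2 / (12 k² log p − log 2)`, whatever `m` — a witness family for `ε → 0` needs `k² log p → ∞`. -/
theorem no_witness_small_eps' {k : ℕ} {ε : ℝ} (hε : 0 < ε)
    (hthr : (p : ℝ) ^ ((4 * k ^ 2 : ℕ) * ε) ≤ (2 : ℝ) ^ ((2 + ε) / 3))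
    {H₁ H₂ H₃ : Subgroup (GLm p m)} (htpp : SubgroupTPP H₁ H₂ H₃)
    (hdes : ∃ c : Mat p m → ℂ, (∀ M, k < M.rank → c M = 0) ∧
      (∑ M, c M * ZMod.stdAddChar (Matrix.trace (M * ((1 : GLm p m) : Mat p m)))) = 1 ∧
      ∀ a ∈ H₁, ∀ b ∈ H₂, ∀ g ∈ H₃, a * b * g ≠ 1 →
        (∑ M, c M * ZMod.stdAddChar
          (Matrix.trace (M * ((a * b * g : GLm p m) : Mat p m)))) = 0) :
    ¬ budget p m k (2 + ε) <
      ((Nat.card H₁ * Nat.card H₂ * Nat.card H₃ : ℕ) : ℝ) ^ ((2 + ε) / 3) := by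
  refine no_witness_small_eps hε (le_trans ?_ hthr) htpp hdes
  have hN : (Nat.card (Submodule (ZMod p) (Fin k ⊕ Fin k → ZMod p)) : ℝ) ≤ (p : ℝ) ^ (4 * k ^ 2) := by
    exact_mod_cast natCard_submodule_le (p := p) (k := k)
  calc (Nat.card (Submodule (ZMod p) (Fin k ⊕ Fin k → ZMod p)) : ℝ) ^ ε
      ≤ ((p : ℝ) ^ (4 * k ^ 2)) ^ ε := Real.rpow_le_rpow (Nat.cast_nonneg _) hN hε.le
    _ = (p : ℝ) ^ ((4 * k ^ 2 : ℕ) * ε) := by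
        rw [← Real.rpow_natCast, ← Real.rpow_mul (Nat.cast_nonneg _)]

end LevelCount
end Summit.MatrixMultiplication.MatrixMultiplication.Theorems.SubgroupIdentityDesigns.Negative
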